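import Summits.CriticalPhenomena.PercolationContinuityZ3.Theorems.PercNearOneGluingNoHeavyLowerTailCubicThreePointStarCells
import Summits.CriticalPhenomena.PercolationContinuityZ3.Theorems.PercNearOneGluingNoHeavyLowerTailCubicThreePointFibreTheta
import Mathlib.Tactic.Ring
import Mathlib.Tactic.Linarith
import HarnessLib

/-!
# `NoHeavyLowerTail` (stmt-CriticalPhenomena-4575) — the three-point cells of the MERGED STAR: `K_{2,3}` on `Fin 5` with the hub–hub edge `{3,4}`
# FORCED (the contracted branch of the one-edge split of the theta graph), as products over the three doubled arms

Support file (prover prim-gen-kcluster gen 24, k-cluster / sharp-cubic-row line; `--supports stmt-CriticalPhenomena-4575`).  No definitions,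
no named facts, no sorries.  Terminals `0, 1, 2`, hubs `3, 4`, random edges `K_{2,3} = {03,13,23,04,14,24}`, forced set `{34}`.  A forced edge
between the two hubs is not expressible by prim-sahi-p2's `pendant`/`join` moves (each doubled arm touches both hubs), so the cells are computed by
a direct pointwise connectivity analysis:
* `merged_exit` — a terminal joined to any other vertex has an open arm (first step of a walk: the only edges at a terminal are its two arms, and
  no terminal lies on the forced edge); `merged_enter` — two terminals with open arms are joined (through the forced edge if the arms go to
  different hubs); hence `merged_memT/U₁/U₂/U₃`: with `{3,4}` forced, `abc ⟺` all three terminals have an open arm, `ab|c ⟺` exactly `a, b` do, …;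
* `merged_T/U₁/U₂/U₃/Q` — the cells as polynomials: products over the three independent doubled arms `mᵢ = pᵢ₃ + pᵢ₄ − pᵢ₃pᵢ₄`
  (`PrW_union_of_pointwise_mul`, `ThetaCells.PrW_pair_or`, `PrW_not`), written exactly in the `z`-polynomials of
  `CubicThreePointHub.hubEdge_sharp` (merged arms `a + A − aA`, …): `z₁ = m₀m₁(1−m₂)`, …, `t_z = m₀m₁m₂`, `q_z = 1 − Σ mᵢmⱼ + 2 m₀m₁m₂`.
Consumed by `…CubicThreePointSharpRowFiveVertices`.
[cite: Gladkov2024StrongFKG, Cor. 4.2 (the three-point cells)]; [cite: Grimmett1999, §2.2 (product measure on configurations)]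
-/


noncomputable section

namespace Summit.CriticalPhenomena.PercolationContinuityZ3.Theorems

namespace ThetaCells

open Finset SimpleGraph Literature.Probability.Percolation Literature.Probability.Percolation.DecisionTree
open CubicThreePointStep CubicThreePointTerminal TerminalGluing

/-! ### The MERGED star: `K_{2,3}` with the hub–hub edge `{3,4}` forced (the contracted branch of the one-edge split) -/

section Merged


/-- An edge of `K_{2,3}` at a terminal is one of its two arms. [folklore] -/
theorem K23_arm_cases : ∀ x z : Fin 5, (x = 0 ∨ x = 1 ∨ x = 2) → s(x, z) ∈ ({s(0, 3), s(1, 3), s(2, 3), s(0, 4), s(1, 4), s(2,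
      4)} : Finset (Sym2 (Fin 5))) → (z = 3 ∨ z = 4) := by decide

/-- No terminal lies on the hub–hub edge. [folklore] -/
theorem terminal_not_hubEdge : ∀ x z : Fin 5, (x = 0 ∨ x = 1 ∨ x = 2) → s(x, z) ≠ s(3, 4) := by decide

/-- EXIT: in `K_{2,3}` with `{3,4}` forced, a terminal joined to another vertex has an open arm. [folklore] -/
theorem merged_exit {S : Finset (Sym2 (Fin 5))} (hS : S ⊆ ({s(0, 3), s(1, 3), s(2, 3), s(0, 4), s(1, 4), s(2,
      4)} : Finset (Sym2 (Fin 5)))) {x y : Fin 5} (hx : x = 0 ∨ x = 1 ∨ x = 2) (hxy : x ≠ y)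
    (h : R (insert s(3, 4) (∅ : Finset (Sym2 (Fin 5)))) S x y) : s(x, 3) ∈ S ∨ s(x, 4) ∈ S := by
  unfold R at h
  obtain ⟨w⟩ := h
  cases w with
  | nil => exact absurd rfl hxy
  | cons hadj _ =>
    rw [fromEdgeSet_adj, Finset.mem_coe, Finset.mem_union, Finset.mem_insert] at hadj
    obtain ⟨hm | hm | hm, _⟩ := hadj
    · rcases K23_arm_cases x _ hx (hS hm) with rfl | rfl
      · exact Or.inl hm
      · exact Or.inr hm
    · exact absurd hm (terminal_not_hubEdge x _ hx)
    · exact absurd hm (Finset.notMem_empty _)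

/-- An open edge joins its endpoints. [folklore] -/
theorem R_of_mem {K S : Finset (Sym2 (Fin 5))} {u v : Fin 5} (huv : u ≠ v) (h : s(u, v) ∈ S) : R K S u v := by
  unfold R
  refine Adj.reachable ?_
  rw [fromEdgeSet_adj, Finset.mem_coe, Finset.mem_union]
  exact ⟨Or.inl h, huv⟩

/-- ENTER: two terminals with open arms are joined through the forced hub–hub edge. [folklore] -/
theorem merged_enter {S : Finset (Sym2 (Fin 5))} {x y : Fin 5} (hx : x = 0 ∨ x = 1 ∨ x = 2) (hy : y = 0 ∨ y = 1 ∨ y = 2)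
    (hAx : s(x, 3) ∈ S ∨ s(x, 4) ∈ S) (hAy : s(y, 3) ∈ S ∨ s(y, 4) ∈ S) : R (insert s(3, 4) (∅ : Finset (Sym2 (Fin 5)))) S x y := by
  have hx3 : x ≠ 3 := by rcases hx with rfl | rfl | rfl <;> decide
  have hx4 : x ≠ 4 := by rcases hx with rfl | rfl | rfl <;> decide
  have hy3 : y ≠ 3 := by rcases hy with rfl | rfl | rfl <;> decide
  have hy4 : y ≠ 4 := by rcases hy with rfl | rfl | rfl <;> decide
  have h34 : R (insert s(3, 4) (∅ : Finset (Sym2 (Fin 5)))) S 3 4 := R_insert_edge (by decide)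
  rcases hAx with h | h <;> rcases hAy with h' | h'
  · exact (R_of_mem hx3 h).trans (R_of_mem hy3 h').symm
  · exact ((R_of_mem hx3 h).trans h34).trans (R_of_mem hy4 h').symm
  · exact ((R_of_mem hx4 h).trans h34.symm).trans (R_of_mem hy3 h').symm
  · exact (R_of_mem hx4 h).trans (R_of_mem hy4 h').symm

variable {S : Finset (Sym2 (Fin 5))} (hS : S ⊆ ({s(0, 3), s(1, 3), s(2, 3), s(0, 4), s(1, 4), s(2, 4)} : Finset (Sym2 (Fin 5))))
include hS

/-- Merged star, `abc` ⟺ all three terminals have an open arm. [folklore] -/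
theorem merged_memT : S ∈ evT (insert s(3, 4) (∅ : Finset (Sym2 (Fin 5)))) 0 1 2 ↔
    (s(0, 3) ∈ S ∨ s(0, 4) ∈ S) ∧ (s(1, 3) ∈ S ∨ s(1, 4) ∈ S) ∧ (s(2, 3) ∈ S ∨ s(2, 4) ∈ S) := by
  rw [mem_evT]
  constructor
  · rintro ⟨h01, h02⟩
    exact ⟨merged_exit hS (Or.inl rfl) (by decide) h01, merged_exit hS (Or.inr (Or.inl rfl)) (by decide) h01.symm,
      merged_exit hS (Or.inr (Or.inr rfl)) (by decide) h02.symm⟩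
  · rintro ⟨h0, h1, h2⟩
    exact ⟨merged_enter (Or.inl rfl) (Or.inr (Or.inl rfl)) h0 h1, merged_enter (Or.inl rfl) (Or.inr (Or.inr rfl)) h0 h2⟩

/-- Merged star, `ab|c` ⟺ `a, b` have an open arm and `c` has none. [folklore] -/
theorem merged_memU₁ : S ∈ evU₁ (insert s(3, 4) (∅ : Finset (Sym2 (Fin 5)))) 0 1 2 ↔
    (s(0, 3) ∈ S ∨ s(0, 4) ∈ S) ∧ (s(1, 3) ∈ S ∨ s(1, 4) ∈ S) ∧ ¬ (s(2, 3) ∈ S ∨ s(2, 4) ∈ S) := by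
  rw [mem_evU₁]
  constructor
  · rintro ⟨h01, h02⟩
    have h0 := merged_exit hS (Or.inl rfl) (by decide) h01
    exact ⟨h0, merged_exit hS (Or.inr (Or.inl rfl)) (by decide) h01.symm,
      fun h2 => h02 (merged_enter (Or.inl rfl) (Or.inr (Or.inr rfl)) h0 h2)⟩
  · rintro ⟨h0, h1, h2⟩
    exact ⟨merged_enter (Or.inl rfl) (Or.inr (Or.inl rfl)) h0 h1,
      fun h02 => h2 (merged_exit hS (Or.inr (Or.inr rfl)) (by decide) h02.symm)⟩

/-- Merged star, `ac|b`. [folklore] -/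
theorem merged_memU₂ : S ∈ evU₂ (insert s(3, 4) (∅ : Finset (Sym2 (Fin 5)))) 0 1 2 ↔
    (s(0, 3) ∈ S ∨ s(0, 4) ∈ S) ∧ ¬ (s(1, 3) ∈ S ∨ s(1, 4) ∈ S) ∧ (s(2, 3) ∈ S ∨ s(2, 4) ∈ S) := by
  rw [mem_evU₂]
  constructor
  · rintro ⟨h02, h01⟩
    have h0 := merged_exit hS (Or.inl rfl) (by decide) h02
    exact ⟨h0, fun h1 => h01 (merged_enter (Or.inl rfl) (Or.inr (Or.inl rfl)) h0 h1),
      merged_exit hS (Or.inr (Or.inr rfl)) (by decide) h02.symm⟩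
  · rintro ⟨h0, h1, h2⟩
    exact ⟨merged_enter (Or.inl rfl) (Or.inr (Or.inr rfl)) h0 h2,
      fun h01 => h1 (merged_exit hS (Or.inr (Or.inl rfl)) (by decide) h01.symm)⟩

/-- Merged star, `bc|a`. [folklore] -/
theorem merged_memU₃ : S ∈ evU₃ (insert s(3, 4) (∅ : Finset (Sym2 (Fin 5)))) 0 1 2 ↔
    ¬ (s(0, 3) ∈ S ∨ s(0, 4) ∈ S) ∧ (s(1, 3) ∈ S ∨ s(1, 4) ∈ S) ∧ (s(2, 3) ∈ S ∨ s(2, 4) ∈ S) := by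
  rw [mem_evU₃]
  constructor
  · rintro ⟨h12, h01⟩
    have h1 := merged_exit hS (Or.inr (Or.inl rfl)) (by decide) h12
    exact ⟨fun h0 => h01 (merged_enter (Or.inl rfl) (Or.inr (Or.inl rfl)) h0 h1), h1,
      merged_exit hS (Or.inr (Or.inr rfl)) (by decide) h12.symm⟩
  · rintro ⟨h0, h1, h2⟩
    exact ⟨merged_enter (Or.inr (Or.inl rfl)) (Or.inr (Or.inr rfl)) h1 h2,
      fun h01 => h0 (merged_exit hS (Or.inl rfl) (by decide) h01)⟩


omit hS

variable (p : Sym2 (Fin 5) → ℝ)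

/-- `K_{2,3}` is the union of the three doubled arms. [folklore] -/
theorem K23_eq_arms : ({s(0, 3), s(1, 3), s(2, 3), s(0, 4), s(1, 4), s(2, 4)} : Finset (Sym2 (Fin 5))) = ({s(0, 3), s(0, 4)} : Finset (Sym2 (Fin 5))) ∪ (({s(1,
      3), s(1, 4)} : Finset (Sym2 (Fin 5))) ∪ ({s(2, 3), s(2, 4)} : Finset (Sym2 (Fin 5)))) := by decide

/-- **Merged star, `t`**: product of the three merged arms `mᵢ = pᵢ₃ + pᵢ₄ − pᵢ₃pᵢ₄`. [folklore] -/
theorem merged_T : PrW ({s(0, 3), s(1, 3), s(2, 3), s(0, 4), s(1, 4), s(2, 4)} : Finset (Sym2 (Fin 5))) p (evT (insert s(3,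
      4) (∅ : Finset (Sym2 (Fin 5)))) 0 1 2) =
    (p s(0, 3) + p s(0, 4) - p s(0, 3) * p s(0, 4)) * (p s(1, 3) + p s(1, 4) - p s(1, 3) * p s(1, 4)) *
      (p s(2, 3) + p s(2, 4) - p s(2, 3) * p s(2, 4)) := by
  rw [K23_eq_arms, PrW_union_of_pointwise_mul p (X := evT (insert s(3, 4) (∅ : Finset (Sym2 (Fin 5)))) 0 1 2)
      (A := {S : Finset (Sym2 (Fin 5)) | s(0, 3) ∈ S ∨ s(0, 4) ∈ S})
      (B := {S : Finset (Sym2 (Fin 5)) | (s(1, 3) ∈ S ∨ s(1, 4) ∈ S) ∧ (s(2, 3) ∈ S ∨ s(2, 4) ∈ S)})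
      (by decide : Disjoint ({s(0, 3), s(0, 4)} : Finset (Sym2 (Fin 5))) (({s(1, 3), s(1, 4)} : Finset (Sym2 (Fin 5))) ∪ ({s(2, 3), s(2,
            4)} : Finset (Sym2 (Fin 5))))) (fun S₁ S₂ h₁ h₂ => ind_eq_mul_of_iff (by
        have hS : S₁ ∪ S₂ ⊆ ({s(0, 3), s(1, 3), s(2, 3), s(0, 4), s(1, 4), s(2,
              4)} : Finset (Sym2 (Fin 5))) := by rw [K23_eq_arms]; exact Finset.union_subset_union h₁ h₂
        rw [merged_memT hS]
        simp only [Set.mem_setOf_eq, mem_union_iff_left h₂ (by decide : s(0, 3) ∉ ({s(1, 3), s(1, 4)} : Finset (Sym2 (Fin 5))) ∪ ({s(2, 3), s(2,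
              4)} : Finset (Sym2 (Fin 5)))), mem_union_iff_left h₂ (by decide : s(0, 4) ∉ ({s(1, 3), s(1, 4)} : Finset (Sym2 (Fin 5))) ∪ ({s(2, 3), s(2,
              4)} : Finset (Sym2 (Fin 5)))), mem_union_iff_right h₁ (by decide : s(1, 3) ∉ ({s(0, 3), s(0, 4)} : Finset (Sym2 (Fin 5)))),
              mem_union_iff_right h₁ (by decide : s(1, 4) ∉ ({s(0, 3), s(0, 4)} : Finset (Sym2 (Fin 5)))), mem_union_iff_right h₁ (by decide : s(2,
                3) ∉ ({s(0, 3), s(0, 4)} : Finset (Sym2 (Fin 5)))),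
          mem_union_iff_right h₁ (by decide : s(2, 4) ∉ ({s(0, 3), s(0, 4)} : Finset (Sym2 (Fin 5))))])),
    PrW_union_of_pointwise_mul p (X := {S : Finset (Sym2 (Fin 5)) | (s(1, 3) ∈ S ∨ s(1, 4) ∈ S) ∧ (s(2, 3) ∈ S ∨ s(2, 4) ∈ S)})
      (A := {S : Finset (Sym2 (Fin 5)) | s(1, 3) ∈ S ∨ s(1, 4) ∈ S}) (B := {S : Finset (Sym2 (Fin 5)) | s(2, 3) ∈ S ∨ s(2, 4) ∈ S})
      (by decide : Disjoint ({s(1, 3), s(1, 4)} : Finset (Sym2 (Fin 5))) ({s(2, 3), s(2, 4)} : Finset (Sym2 (Fin 5)))) (fun S₁ S₂ h₁ h₂ => ind_eq_mul_of_iff (by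
        simp only [Set.mem_setOf_eq, mem_union_iff_left h₂ (by decide : s(1, 3) ∉ ({s(2, 3), s(2, 4)} : Finset (Sym2 (Fin 5)))),
              mem_union_iff_left h₂ (by decide : s(1, 4) ∉ ({s(2, 3), s(2, 4)} : Finset (Sym2 (Fin 5)))), mem_union_iff_right h₁ (by decide : s(2,
                3) ∉ ({s(1, 3), s(1, 4)} : Finset (Sym2 (Fin 5)))),
          mem_union_iff_right h₁ (by decide : s(2, 4) ∉ ({s(1, 3), s(1, 4)} : Finset (Sym2 (Fin 5))))])),
    PrW_pair_or p (by decide), PrW_pair_or p (by decide), PrW_pair_or p (by decide)]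
  ring

/-- **Merged star, `u₁ = P(ab|c)`** `= m₀ m₁ (1 − m₂)`. [folklore] -/
theorem merged_U₁ : PrW ({s(0, 3), s(1, 3), s(2, 3), s(0, 4), s(1, 4), s(2, 4)} : Finset (Sym2 (Fin 5))) p (evU₁ (insert s(3,
      4) (∅ : Finset (Sym2 (Fin 5)))) 0 1 2) = (p s(0, 3) + p s(0, 4) - p s(0, 3) * p s(0, 4)) * (p s(1, 3) + p s(1, 4) - p s(1, 3) * p s(1, 4)) * (1 - (p s(2,
      3) + p s(2, 4) - p s(2, 3) * p s(2, 4))) := by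
  rw [K23_eq_arms, PrW_union_of_pointwise_mul p (X := evU₁ (insert s(3, 4) (∅ : Finset (Sym2 (Fin 5)))) 0 1 2)
      (A := {S : Finset (Sym2 (Fin 5)) | s(0, 3) ∈ S ∨ s(0, 4) ∈ S})
      (B := {S : Finset (Sym2 (Fin 5)) | (s(1, 3) ∈ S ∨ s(1, 4) ∈ S) ∧ ¬ (s(2, 3) ∈ S ∨ s(2, 4) ∈ S)})
      (by decide : Disjoint ({s(0, 3), s(0, 4)} : Finset (Sym2 (Fin 5))) (({s(1, 3), s(1, 4)} : Finset (Sym2 (Fin 5))) ∪ ({s(2, 3), s(2,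
            4)} : Finset (Sym2 (Fin 5))))) (fun S₁ S₂ h₁ h₂ => ind_eq_mul_of_iff (by
        have hS : S₁ ∪ S₂ ⊆ ({s(0, 3), s(1, 3), s(2, 3), s(0, 4), s(1, 4), s(2,
              4)} : Finset (Sym2 (Fin 5))) := by rw [K23_eq_arms]; exact Finset.union_subset_union h₁ h₂
        rw [merged_memU₁ hS]
        simp only [Set.mem_setOf_eq, mem_union_iff_left h₂ (by decide : s(0, 3) ∉ ({s(1, 3), s(1, 4)} : Finset (Sym2 (Fin 5))) ∪ ({s(2, 3), s(2,
              4)} : Finset (Sym2 (Fin 5)))), mem_union_iff_left h₂ (by decide : s(0, 4) ∉ ({s(1, 3), s(1, 4)} : Finset (Sym2 (Fin 5))) ∪ ({s(2, 3), s(2,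
              4)} : Finset (Sym2 (Fin 5)))), mem_union_iff_right h₁ (by decide : s(1, 3) ∉ ({s(0, 3), s(0, 4)} : Finset (Sym2 (Fin 5)))),
              mem_union_iff_right h₁ (by decide : s(1, 4) ∉ ({s(0, 3), s(0, 4)} : Finset (Sym2 (Fin 5)))), mem_union_iff_right h₁ (by decide : s(2,
                3) ∉ ({s(0, 3), s(0, 4)} : Finset (Sym2 (Fin 5)))),
          mem_union_iff_right h₁ (by decide : s(2, 4) ∉ ({s(0, 3), s(0, 4)} : Finset (Sym2 (Fin 5))))])),
    PrW_union_of_pointwise_mul p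
      (X := {S : Finset (Sym2 (Fin 5)) | (s(1, 3) ∈ S ∨ s(1, 4) ∈ S) ∧ ¬ (s(2, 3) ∈ S ∨ s(2, 4) ∈ S)})
      (A := {S : Finset (Sym2 (Fin 5)) | s(1, 3) ∈ S ∨ s(1, 4) ∈ S}) (B := {S : Finset (Sym2 (Fin 5)) | ¬ (s(2, 3) ∈ S ∨ s(2, 4) ∈ S)})
      (by decide : Disjoint ({s(1, 3), s(1, 4)} : Finset (Sym2 (Fin 5))) ({s(2, 3), s(2, 4)} : Finset (Sym2 (Fin 5)))) (fun S₁ S₂ h₁ h₂ => ind_eq_mul_of_iff (by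
        simp only [Set.mem_setOf_eq, mem_union_iff_left h₂ (by decide : s(1, 3) ∉ ({s(2, 3), s(2, 4)} : Finset (Sym2 (Fin 5)))),
              mem_union_iff_left h₂ (by decide : s(1, 4) ∉ ({s(2, 3), s(2, 4)} : Finset (Sym2 (Fin 5)))), mem_union_iff_right h₁ (by decide : s(2,
                3) ∉ ({s(1, 3), s(1, 4)} : Finset (Sym2 (Fin 5)))),
          mem_union_iff_right h₁ (by decide : s(2, 4) ∉ ({s(1, 3), s(1, 4)} : Finset (Sym2 (Fin 5))))])),
    PrW_not p ({s(2, 3), s(2, 4)} : Finset (Sym2 (Fin 5))) (fun S => s(2, 3) ∈ S ∨ s(2, 4) ∈ S),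
    PrW_pair_or p (by decide), PrW_pair_or p (by decide), PrW_pair_or p (by decide)]
  ring

/-- **Merged star, `u₂ = P(ac|b)`** `= m₀ m₂ (1 − m₁)`. [folklore] -/
theorem merged_U₂ : PrW ({s(0, 3), s(1, 3), s(2, 3), s(0, 4), s(1, 4), s(2, 4)} : Finset (Sym2 (Fin 5))) p (evU₂ (insert s(3,
      4) (∅ : Finset (Sym2 (Fin 5)))) 0 1 2) = (p s(0, 3) + p s(0, 4) - p s(0, 3) * p s(0, 4)) * (p s(2, 3) + p s(2, 4) - p s(2, 3) * p s(2, 4)) * (1 - (p s(1,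
      3) + p s(1, 4) - p s(1, 3) * p s(1, 4))) := by
  rw [K23_eq_arms, PrW_union_of_pointwise_mul p (X := evU₂ (insert s(3, 4) (∅ : Finset (Sym2 (Fin 5)))) 0 1 2)
      (A := {S : Finset (Sym2 (Fin 5)) | s(0, 3) ∈ S ∨ s(0, 4) ∈ S})
      (B := {S : Finset (Sym2 (Fin 5)) | ¬ (s(1, 3) ∈ S ∨ s(1, 4) ∈ S) ∧ (s(2, 3) ∈ S ∨ s(2, 4) ∈ S)})
      (by decide : Disjoint ({s(0, 3), s(0, 4)} : Finset (Sym2 (Fin 5))) (({s(1, 3), s(1, 4)} : Finset (Sym2 (Fin 5))) ∪ ({s(2, 3), s(2,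
            4)} : Finset (Sym2 (Fin 5))))) (fun S₁ S₂ h₁ h₂ => ind_eq_mul_of_iff (by
        have hS : S₁ ∪ S₂ ⊆ ({s(0, 3), s(1, 3), s(2, 3), s(0, 4), s(1, 4), s(2,
              4)} : Finset (Sym2 (Fin 5))) := by rw [K23_eq_arms]; exact Finset.union_subset_union h₁ h₂
        rw [merged_memU₂ hS]
        simp only [Set.mem_setOf_eq, mem_union_iff_left h₂ (by decide : s(0, 3) ∉ ({s(1, 3), s(1, 4)} : Finset (Sym2 (Fin 5))) ∪ ({s(2, 3), s(2,
              4)} : Finset (Sym2 (Fin 5)))), mem_union_iff_left h₂ (by decide : s(0, 4) ∉ ({s(1, 3), s(1, 4)} : Finset (Sym2 (Fin 5))) ∪ ({s(2, 3), s(2,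
              4)} : Finset (Sym2 (Fin 5)))), mem_union_iff_right h₁ (by decide : s(1, 3) ∉ ({s(0, 3), s(0, 4)} : Finset (Sym2 (Fin 5)))),
              mem_union_iff_right h₁ (by decide : s(1, 4) ∉ ({s(0, 3), s(0, 4)} : Finset (Sym2 (Fin 5)))), mem_union_iff_right h₁ (by decide : s(2,
                3) ∉ ({s(0, 3), s(0, 4)} : Finset (Sym2 (Fin 5)))),
          mem_union_iff_right h₁ (by decide : s(2, 4) ∉ ({s(0, 3), s(0, 4)} : Finset (Sym2 (Fin 5))))])),
    PrW_union_of_pointwise_mul p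
      (X := {S : Finset (Sym2 (Fin 5)) | ¬ (s(1, 3) ∈ S ∨ s(1, 4) ∈ S) ∧ (s(2, 3) ∈ S ∨ s(2, 4) ∈ S)})
      (A := {S : Finset (Sym2 (Fin 5)) | ¬ (s(1, 3) ∈ S ∨ s(1, 4) ∈ S)}) (B := {S : Finset (Sym2 (Fin 5)) | s(2, 3) ∈ S ∨ s(2, 4) ∈ S})
      (by decide : Disjoint ({s(1, 3), s(1, 4)} : Finset (Sym2 (Fin 5))) ({s(2, 3), s(2, 4)} : Finset (Sym2 (Fin 5)))) (fun S₁ S₂ h₁ h₂ => ind_eq_mul_of_iff (by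
        simp only [Set.mem_setOf_eq, mem_union_iff_left h₂ (by decide : s(1, 3) ∉ ({s(2, 3), s(2, 4)} : Finset (Sym2 (Fin 5)))),
              mem_union_iff_left h₂ (by decide : s(1, 4) ∉ ({s(2, 3), s(2, 4)} : Finset (Sym2 (Fin 5)))), mem_union_iff_right h₁ (by decide : s(2,
                3) ∉ ({s(1, 3), s(1, 4)} : Finset (Sym2 (Fin 5)))),
          mem_union_iff_right h₁ (by decide : s(2, 4) ∉ ({s(1, 3), s(1, 4)} : Finset (Sym2 (Fin 5))))])),
    PrW_not p ({s(1, 3), s(1, 4)} : Finset (Sym2 (Fin 5))) (fun S => s(1, 3) ∈ S ∨ s(1, 4) ∈ S),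
    PrW_pair_or p (by decide), PrW_pair_or p (by decide), PrW_pair_or p (by decide)]
  ring

/-- **Merged star, `u₃ = P(bc|a)`** `= m₁ m₂ (1 − m₀)`. [folklore] -/
theorem merged_U₃ : PrW ({s(0, 3), s(1, 3), s(2, 3), s(0, 4), s(1, 4), s(2, 4)} : Finset (Sym2 (Fin 5))) p (evU₃ (insert s(3,
      4) (∅ : Finset (Sym2 (Fin 5)))) 0 1 2) = (p s(1, 3) + p s(1, 4) - p s(1, 3) * p s(1, 4)) * (p s(2, 3) + p s(2, 4) - p s(2, 3) * p s(2, 4)) * (1 - (p s(0,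
      3) + p s(0, 4) - p s(0, 3) * p s(0, 4))) := by
  rw [K23_eq_arms, PrW_union_of_pointwise_mul p (X := evU₃ (insert s(3, 4) (∅ : Finset (Sym2 (Fin 5)))) 0 1 2)
      (A := {S : Finset (Sym2 (Fin 5)) | ¬ (s(0, 3) ∈ S ∨ s(0, 4) ∈ S)})
      (B := {S : Finset (Sym2 (Fin 5)) | (s(1, 3) ∈ S ∨ s(1, 4) ∈ S) ∧ (s(2, 3) ∈ S ∨ s(2, 4) ∈ S)})
      (by decide : Disjoint ({s(0, 3), s(0, 4)} : Finset (Sym2 (Fin 5))) (({s(1, 3), s(1, 4)} : Finset (Sym2 (Fin 5))) ∪ ({s(2, 3), s(2,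
            4)} : Finset (Sym2 (Fin 5))))) (fun S₁ S₂ h₁ h₂ => ind_eq_mul_of_iff (by
        have hS : S₁ ∪ S₂ ⊆ ({s(0, 3), s(1, 3), s(2, 3), s(0, 4), s(1, 4), s(2,
              4)} : Finset (Sym2 (Fin 5))) := by rw [K23_eq_arms]; exact Finset.union_subset_union h₁ h₂
        rw [merged_memU₃ hS]
        simp only [Set.mem_setOf_eq, mem_union_iff_left h₂ (by decide : s(0, 3) ∉ ({s(1, 3), s(1, 4)} : Finset (Sym2 (Fin 5))) ∪ ({s(2, 3), s(2,
              4)} : Finset (Sym2 (Fin 5)))), mem_union_iff_left h₂ (by decide : s(0, 4) ∉ ({s(1, 3), s(1, 4)} : Finset (Sym2 (Fin 5))) ∪ ({s(2, 3), s(2,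
              4)} : Finset (Sym2 (Fin 5)))), mem_union_iff_right h₁ (by decide : s(1, 3) ∉ ({s(0, 3), s(0, 4)} : Finset (Sym2 (Fin 5)))),
              mem_union_iff_right h₁ (by decide : s(1, 4) ∉ ({s(0, 3), s(0, 4)} : Finset (Sym2 (Fin 5)))), mem_union_iff_right h₁ (by decide : s(2,
                3) ∉ ({s(0, 3), s(0, 4)} : Finset (Sym2 (Fin 5)))),
          mem_union_iff_right h₁ (by decide : s(2, 4) ∉ ({s(0, 3), s(0, 4)} : Finset (Sym2 (Fin 5))))])),
    PrW_union_of_pointwise_mul p (X := {S : Finset (Sym2 (Fin 5)) | (s(1, 3) ∈ S ∨ s(1, 4) ∈ S) ∧ (s(2, 3) ∈ S ∨ s(2, 4) ∈ S)})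
      (A := {S : Finset (Sym2 (Fin 5)) | s(1, 3) ∈ S ∨ s(1, 4) ∈ S}) (B := {S : Finset (Sym2 (Fin 5)) | s(2, 3) ∈ S ∨ s(2, 4) ∈ S})
      (by decide : Disjoint ({s(1, 3), s(1, 4)} : Finset (Sym2 (Fin 5))) ({s(2, 3), s(2, 4)} : Finset (Sym2 (Fin 5)))) (fun S₁ S₂ h₁ h₂ => ind_eq_mul_of_iff (by
        simp only [Set.mem_setOf_eq, mem_union_iff_left h₂ (by decide : s(1, 3) ∉ ({s(2, 3), s(2, 4)} : Finset (Sym2 (Fin 5)))),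
              mem_union_iff_left h₂ (by decide : s(1, 4) ∉ ({s(2, 3), s(2, 4)} : Finset (Sym2 (Fin 5)))), mem_union_iff_right h₁ (by decide : s(2,
                3) ∉ ({s(1, 3), s(1, 4)} : Finset (Sym2 (Fin 5)))),
          mem_union_iff_right h₁ (by decide : s(2, 4) ∉ ({s(1, 3), s(1, 4)} : Finset (Sym2 (Fin 5))))])),
    PrW_not p ({s(0, 3), s(0, 4)} : Finset (Sym2 (Fin 5))) (fun S => s(0, 3) ∈ S ∨ s(0, 4) ∈ S),
    PrW_pair_or p (by decide), PrW_pair_or p (by decide), PrW_pair_or p (by decide)]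
  ring

/-- **Merged star, `q = P(a|b|c)`** `= 1 − (m₀m₁ + m₀m₂ + m₁m₂) + 2 m₀m₁m₂` (the star cell of the merged arms). [folklore] -/
theorem merged_Q : PrW ({s(0, 3), s(1, 3), s(2, 3), s(0, 4), s(1, 4), s(2, 4)} : Finset (Sym2 (Fin 5))) p (evQ (insert s(3,
      4) (∅ : Finset (Sym2 (Fin 5)))) 0 1 2) =
    1 - ((p s(0, 3) + p s(0, 4) - p s(0, 3) * p s(0, 4)) * (p s(1, 3) + p s(1, 4) - p s(1, 3) * p s(1, 4)) + (p s(0, 3) + p s(0, 4) - p s(0, 3) * p s(0,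
          4)) * (p s(2, 3) + p s(2, 4) - p s(2, 3) * p s(2, 4)) + (p s(1, 3) + p s(1, 4) - p s(1, 3) * p s(1, 4)) * (p s(2, 3) + p s(2, 4) - p s(2, 3) * p s(2,
          4))) + 2 * ((p s(0, 3) + p s(0, 4) - p s(0, 3) * p s(0, 4)) * (p s(1, 3) + p s(1, 4) - p s(1, 3) * p s(1, 4)) * (p s(2, 3) + p s(2, 4) - p s(2,
          3) * p s(2, 4))) := by
  have h := PrW_cells_sum_one ({s(0, 3), s(1, 3), s(2, 3), s(0, 4), s(1, 4), s(2, 4)} : Finset (Sym2 (Fin 5))) p (insert s(3,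
        4) (∅ : Finset (Sym2 (Fin 5)))) 0 1 2
  rw [merged_U₁, merged_U₂, merged_U₃, merged_T] at h
  linear_combination h

end Merged


end ThetaCells

end Summit.CriticalPhenomena.PercolationContinuityZ3.Theorems

end
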